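import Literature.NumberTheory.EllipticCurves.SelmerGaloisActionLocal
import Literature.NumberTheory.GaloisRepresentations.LocalTatePairing
import Literature.NumberTheory.GaloisRepresentations.ContinuousCupProductCompat
import HarnessLib

/-!
# Semilinear (outer) Galois actions on local cohomology in every degree: `σ_* : Hᵈ(Γ_E, M) → Hᵈ(Γ_{E'}, M)`
# for a discrete `Γ_K`-module with a `τ`-semilinear automorphism, and compatibility with cup products

Generalises `SelmerGaloisActionLocal.lean` (the case `M = E[n]`, `d = 1`, `ψ = τ` on points) to an
ARBITRARY discrete `Γ_K`-module `ρ` on `M` equipped with a **`τ`-semilinear endomorphism**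
`ψ : M →+ M` for a lift `τ` of `σ ∈ Aut(K/k)` to `K̄` — `ψ (ρ(τ⁻¹ g τ) m) = ρ(g) (ψ m)`
(`IsSemilinear`; examples: `τ` on `E[n]` (`IsLiftOfAut.torsionMap_smul`), `τ` on `μₙ(K̄)`, and
`f ↦ τ ∘ f ∘ τ⁻¹` on a Tate dual `Hom(M, μₙ)`), and to every degree `d` (Mathlib
`ContinuousCohomology.map` along the compatible pair `(g ↦ τ⁻¹ g τ, ψ)`, resp. locally
`(g ↦ Θ⁻¹ g Θ, ψ)` for a lift `Θ : K̄_E ≃+* K̄_{E'}` of a `σ`-semilinear `θ : E ≃+* E'` and a `τ` adapted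
to it, `LiftsCommute τ Θ`):

* `semilinearH ρ hτ ψ hψ d : Hᵈ(K, M) →+ Hᵈ(K, M)` (for `E[n]`, `d = 1`: `conjAct`, `semilinearH_one_eq_conjH1`);
* `semilinearLocalH ρ hτ hΘ hc ψ hψ d : Hᵈ(Γ_E, M) →+ Hᵈ(Γ_{E'}, M)` (for `E[n]`, `d = 1`:
  `localConjH1`, `semilinearLocalH_one_eq_localConjH1`);
* `semilinearLocalH_res` — **`σ_{*,loc} ∘ res_E = res_{E'} ∘ σ_*` in every degree** (functoriality
  `ContinuousCohomology.map_comp` and the identity of compatible pairs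
  `res_E ∘ (Θ⁻¹·Θ) = (τ⁻¹·τ) ∘ res_{E'}`, `LiftsCommute.absGaloisRestrict_conjGalCMH`);
* `semilinearLocalH_one_semilinearLocalH_one` — round trip in degree `1` (inner pair ⇒ coboundary);
* `semilinearLocalH_cupProduct` — **compatibility with cup products**: for an equivariant pairing
  `B : M × N → P` and semilinear `ψ_M, ψ_N, ψ_P` with `B (ψ_M m) (ψ_N n) = ψ_P (B m n)`,
  `σ_*^{(2)} (a ∪ b) = σ_* a ∪ σ_* b` in `H²(Γ_{E'}, P)` (NSW (1.4.2); at the level of the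
  inhomogeneous cocycle `(g, h) ↦ ⟨f g, g • f' h⟩`).

With `B` the evaluation `M × M^∨(1) → μₙ` this is the input «`∑_v inv_v(σ_* x ∪ σ_* y) = ∑_v inv_v(x ∪ y)`
as soon as `inv_{σ v} ∘ σ_* = inv_v`» of the `±`-eigenspace form of Poitou–Tate duality (Jetchev 2008
§5, Thm. 5.1 «with respect to `∑_v ⟨,⟩_v^±`»). Everything is PROVED; no named facts, no instances,
no notation.

## References

* J.-P. Serre, *Galois Cohomology* (1997), I.§2.4 (compatible pairs), II.§1.1; *Local Fields*
  (1979), VII.§5 Prop. 3. [SerreGaloisCohomology1997] [SerreLocalFields1979]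
* J. Neukirch, A. Schmidt, K. Wingberg, *Cohomology of Number Fields* (2008), I §4 (1.4.2), I §5
  (conjugation `σ_*` on cohomology). [NeukirchSchmidtWingberg2008]
* D. Jetchev, Compos. Math. 144 (2008), §5, Thm. 5.1. [Jetchev2008]
-/

noncomputable section

open scoped Classical
open Field CategoryTheory
open Literature.NumberTheory.GaloisRepresentations

universe u v w

namespace Literature.NumberTheory.EllipticCurves

/-! ### Semilinear endomorphisms and the global action -/

section Global

variable {k : Type v} {K : Type u} [Field k] [Field K] [Algebra k K]
variable {M : Type u} [AddCommGroup M] [TopologicalSpace M] [DiscreteTopology M]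
variable (ρ : DiscreteGaloisModule K M) {σ : K ≃ₐ[k] K}
  {τ : AlgebraicClosure K ≃+* AlgebraicClosure K}

/-- A **`τ`-semilinear endomorphism** of the discrete `Γ_K`-module `ρ` for a lift `τ` of
`σ ∈ Aut(K/k)`: `ψ (ρ(τ⁻¹ g τ) m) = ρ(g) (ψ m)`, i.e. `(g ↦ τ⁻¹ g τ, ψ)` is a compatible pair; this is
how an automorphism of `K̄` NOT fixing `K` acts on a module «defined over `k`» (`E[n]`:
`IsLiftOfAut.torsionMap_smul`; `μₙ`; Tate duals). [cite: SerreGaloisCohomology1997, I.§2.4 (compatible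
pairs)] [cite: NeukirchSchmidtWingberg2008, I §5 (conjugation on cohomology)] -/
def IsSemilinear (hτ : IsLiftOfAut σ τ) (ψ : M →+ M) : Prop :=
  ∀ (g : absoluteGaloisGroup K) (m : M), ψ (ρ (hτ.conjGalCMH g) m) = ρ g (ψ m)

variable {ρ}

/-- The morphism `res_{τ⁻¹·τ} M ⟶ M` of topological `Γ_K`-representations given by a `τ`-semilinear
`ψ`. [cite: SerreGaloisCohomology1997, I.§2.4 (compatible pairs)] -/
def semilinearHom (hτ : IsLiftOfAut σ τ) (ψ : M →+ M) (hψ : IsSemilinear ρ hτ ψ) :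
    TopRep.res (hτ.conjGalCMH : absoluteGaloisGroup K →* absoluteGaloisGroup K) ρ.toTopRep ⟶
      ρ.toTopRep :=
  TopRep.ofHom
    { toContinuousLinearMap := ⟨ψ.toIntLinearMap, continuous_of_discreteTopology⟩
      isIntertwining' := fun g => ContinuousLinearMap.ext fun m => hψ g m }

/-- Unfolding `semilinearHom`. [cite: SerreGaloisCohomology1997, I.§2.4 (compatible pairs)] -/
theorem semilinearHom_hom_apply (hτ : IsLiftOfAut σ τ) (ψ : M →+ M)
    (hψ : IsSemilinear ρ hτ ψ) (m : M) : (semilinearHom hτ ψ hψ).hom m = ψ m := rfl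

/-- **The semilinear action on `Hᵈ(K, M)`** along the compatible pair `(g ↦ τ⁻¹ g τ, ψ)` (Mathlib
`ContinuousCohomology.map`). For `M = E[n]`, `ψ = τ`, `d = 1` this is `conjAct W σ n`
(`semilinearH_one_eq_conjH1`). [cite: NeukirchSchmidtWingberg2008, I §5 (conjugation on cohomology)]
[cite: GrossLMS1991, §5 (5.1)] -/
def semilinearH (hτ : IsLiftOfAut σ τ) (ψ : M →+ M) (hψ : IsSemilinear ρ hτ ψ) (d : ℕ) :
    galoisCohomology ρ d →+ galoisCohomology ρ d :=
  (ContinuousCohomology.map hτ.conjGalCMH (semilinearHom hτ ψ hψ) d).hom.toLinearMap.toAddMonoidHom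

/-- For `E[n]` with `ψ = τ` on points: `semilinearH … 1 = IsLiftOfAut.conjH1` (`= conjAct`),
definitionally. [cite: GrossLMS1991, §5 (5.1)] -/
theorem semilinearH_one_eq_conjH1 {K : Type u} [Field K] [Algebra k K] (W : WeierstrassCurve k)
    {σ : K ≃ₐ[k] K} {τ : AlgebraicClosure K ≃+* AlgebraicClosure K} (hτ : IsLiftOfAut σ τ)
    (n : ℤ) :
    semilinearH (ρ := (W.baseChange K).torsionGaloisModule n) hτ (hτ.torsionMap W n)
      (hτ.torsionMap_smul W n) 1 = hτ.conjH1 W n := rfl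

end Global

/-! ### The local action in every degree -/

section Local

variable {K : Type u} [Field K] [CharZero K]
variable {M : Type u} [AddCommGroup M] [TopologicalSpace M] [DiscreteTopology M]
variable {ρ : DiscreteGaloisModule K M}
variable {E E' : Type u} [Field E] [Algebra K E] [Field E'] [Algebra K E']
variable {σ : K ≃ₐ[ℚ] K} {τ : AlgebraicClosure K ≃+* AlgebraicClosure K} {θ : E ≃+* E'}
  {Θ : AlgebraicClosure E ≃+* AlgebraicClosure E'}

/-- A `τ`-semilinear `ψ` is a compatible pair with `g ↦ Θ⁻¹ g Θ : Γ_{E'} → Γ_E` for the RESTRICTED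
modules `M|_{Γ_E}`, `M|_{Γ_{E'}}` when `(τ, Θ)` are adapted (`res_E (Θ⁻¹ g Θ) = τ⁻¹ (res_{E'} g) τ`).
[cite: SerreGaloisCohomology1997, II.§1.1 and I.§2.4] -/
theorem IsSemilinear.restrictField (hτ : IsLiftOfAut σ τ) (hΘ : IsLiftOfRingEquiv θ Θ)
    (hc : LiftsCommute τ Θ) {ψ : M →+ M} (hψ : IsSemilinear ρ hτ ψ)
    (g : absoluteGaloisGroup E') (m : M) :
    ψ (GaloisRep.restrictField E ρ (hΘ.conjGalCMH g) m) =
      GaloisRep.restrictField E' ρ g (ψ m) := by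
  rw [GaloisRep.restrictField_apply, GaloisRep.restrictField_apply,
    hc.absGaloisRestrict_conjGalCMH hτ hΘ]
  exact hψ _ m

/-- The morphism `res_{Θ⁻¹·Θ} (M|_{Γ_E}) ⟶ M|_{Γ_{E'}}` of topological `Γ_{E'}`-representations given by
`ψ`. [cite: SerreGaloisCohomology1997, I.§2.4 (compatible pairs)] -/
def semilinearLocalHom (hτ : IsLiftOfAut σ τ) (hΘ : IsLiftOfRingEquiv θ Θ)
    (hc : LiftsCommute τ Θ) (ψ : M →+ M) (hψ : IsSemilinear ρ hτ ψ) :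
    TopRep.res (hΘ.conjGalCMH : absoluteGaloisGroup E' →* absoluteGaloisGroup E)
        (DiscreteGaloisModule.toTopRep (GaloisRep.restrictField E ρ)) ⟶
      DiscreteGaloisModule.toTopRep (GaloisRep.restrictField E' ρ) :=
  TopRep.ofHom
    { toContinuousLinearMap := ⟨ψ.toIntLinearMap, continuous_of_discreteTopology⟩
      isIntertwining' := fun g => ContinuousLinearMap.ext fun m =>
        hψ.restrictField hτ hΘ hc g m }

/-- Unfolding `semilinearLocalHom`. [cite: SerreGaloisCohomology1997, I.§2.4 (compatible pairs)] -/
theorem semilinearLocalHom_hom_apply (hτ : IsLiftOfAut σ τ) (hΘ : IsLiftOfRingEquiv θ Θ)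
    (hc : LiftsCommute τ Θ) (ψ : M →+ M) (hψ : IsSemilinear ρ hτ ψ) (m : M) :
    (semilinearLocalHom hτ hΘ hc ψ hψ).hom m = ψ m := rfl

/-- **The semilinear local action `σ_* : Hᵈ(Γ_E, M) →+ Hᵈ(Γ_{E'}, M)`** along `(g ↦ Θ⁻¹ g Θ, ψ)`,
in every degree `d`. For `E = K_v`, `E' = K_{σ v}` and `θ` the Galois transport of completions this
is the conjugation `σ_*` on local cohomology (Cassels–Fröhlich VII §1.1; NSW I §5).
[cite: NeukirchSchmidtWingberg2008, I §5 (conjugation on cohomology)]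
[cite: CasselsFrohlichANT1967, Ch. VII §1.1] -/
def semilinearLocalH (hτ : IsLiftOfAut σ τ) (hΘ : IsLiftOfRingEquiv θ Θ)
    (hc : LiftsCommute τ Θ) (ψ : M →+ M) (hψ : IsSemilinear ρ hτ ψ) (d : ℕ) :
    galoisCohomology (GaloisRep.restrictField E ρ) d →+
      galoisCohomology (GaloisRep.restrictField E' ρ) d :=
  (ContinuousCohomology.map hΘ.conjGalCMH (semilinearLocalHom hτ hΘ hc ψ hψ) d).hom.toLinearMap.toAddMonoidHom

/-- For `E[n]`, `ψ = τ`, `d = 1`: `semilinearLocalH = localConjH1` (definitionally).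
[cite: CasselsFrohlichANT1967, Ch. VII §1.1] -/
theorem semilinearLocalH_one_eq_localConjH1 (W : WeierstrassCurve ℚ) (hτ : IsLiftOfAut σ τ)
    (hΘ : IsLiftOfRingEquiv θ Θ) (hc : LiftsCommute τ Θ) (n : ℤ) :
    semilinearLocalH (ρ := (W.baseChange K).torsionGaloisModule n) hτ hΘ hc
      (hτ.torsionMap W n) (hτ.torsionMap_smul W n) 1 = localConjH1 W hτ hΘ hc n := rfl

/-! ### Compatibility with restriction, in every degree -/

/-- Congruence for `ContinuousCohomology.map` along equal group homomorphisms and pointwise-equal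
morphisms (`subst`). [cite: SerreGaloisCohomology1997, I.§2.4 (compatible pairs)] -/
theorem map_congr_of_eq {R : Type w} [Ring R] [TopologicalSpace R]
    {G H : Type v} [Group G] [TopologicalSpace G] [IsTopologicalGroup G]
    [Group H] [TopologicalSpace H] [IsTopologicalGroup H]
    {X : TopRep.{v} R G} {Y : TopRep.{v} R H} {φ φ' : H →ₜ* G} (hφ : φ = φ')
    (f : TopRep.res (φ : H →* G) X ⟶ Y) (f' : TopRep.res (φ' : H →* G) X ⟶ Y)
    (hf : ∀ x, f.hom x = f'.hom x) (d : ℕ) :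
    ContinuousCohomology.map φ f d = ContinuousCohomology.map φ' f' d := by
  subst hφ
  have : f = f' := TopRep.hom_ext (ContIntertwiningMap.ext (ContinuousLinearMap.ext hf))
  rw [this]

/-- **`σ_{*,loc} ∘ res_E = res_{E'} ∘ σ_*` in every degree `d`**: both composites are
`ContinuousCohomology.map` along ONE compatible pair (`map_comp`), and the two pairs coincide:
`res_E ∘ (Θ⁻¹·Θ) = (τ⁻¹·τ) ∘ res_{E'}` (`LiftsCommute.absGaloisRestrict_conjGalCMH`), `id ∘ ψ = ψ ∘ id`.
With `E = K_v`: `loc_{σ v}(σ_* c) = σ_* (loc_v c)`. [cite: Jetchev2008, §5 Thm. 5.1]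
[cite: NeukirchSchmidtWingberg2008, I §5] -/
theorem semilinearLocalH_res (hτ : IsLiftOfAut σ τ) (hΘ : IsLiftOfRingEquiv θ Θ)
    (hc : LiftsCommute τ Θ) (ψ : M →+ M) (hψ : IsSemilinear ρ hτ ψ) (d : ℕ)
    (c : galoisCohomology ρ d) :
    semilinearLocalH hτ hΘ hc ψ hψ d (galoisCohomology.res ρ E d c) =
      galoisCohomology.res ρ E' d (semilinearH hτ ψ hψ d c) := by
  -- the four morphisms of topological representations involved
  let rE : TopRep.res (absGaloisRestrict K E : absoluteGaloisGroup E →* absoluteGaloisGroup K)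
      ρ.toTopRep ⟶ DiscreteGaloisModule.toTopRep (GaloisRep.restrictField E ρ) :=
    TopRep.ofHom ⟨ContinuousLinearMap.id ℤ M, fun _ => rfl⟩
  let rE' : TopRep.res (absGaloisRestrict K E' : absoluteGaloisGroup E' →* absoluteGaloisGroup K)
      ρ.toTopRep ⟶ DiscreteGaloisModule.toTopRep (GaloisRep.restrictField E' ρ) :=
    TopRep.ofHom ⟨ContinuousLinearMap.id ℤ M, fun _ => rfl⟩
  -- both composites are `ContinuousCohomology.map` along ONE compatible pair, and the pairs agree
  have hcomp : ContinuousCohomology.map (absGaloisRestrict K E) rE d ≫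
      ContinuousCohomology.map hΘ.conjGalCMH (semilinearLocalHom hτ hΘ hc ψ hψ) d =
      ContinuousCohomology.map hτ.conjGalCMH (semilinearHom hτ ψ hψ) d ≫
        ContinuousCohomology.map (absGaloisRestrict K E') rE' d := by
    rw [← ContinuousCohomology.map_comp, ← ContinuousCohomology.map_comp]
    exact map_congr_of_eq (X := ρ.toTopRep)
      (Y := DiscreteGaloisModule.toTopRep (GaloisRep.restrictField E' ρ))
      (φ := (absGaloisRestrict K E).comp hΘ.conjGalCMH)
      (φ' := hτ.conjGalCMH.comp (absGaloisRestrict K E'))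
      (ContinuousMonoidHom.ext fun g => hc.absGaloisRestrict_conjGalCMH hτ hΘ g)
      _ _ (fun _ => rfl) d
  have happ := congrArg (fun T => TopModuleCat.Hom.hom T c) hcomp
  simp only [TopModuleCat.hom_comp, ContinuousLinearMap.comp_apply] at happ
  exact happ

/-! ### Round trip in degree one -/

section RoundTrip

variable {σ' : K ≃ₐ[ℚ] K} {τ₂ : AlgebraicClosure K ≃+* AlgebraicClosure K} {θ' : E' ≃+* E}
  {Θ' : AlgebraicClosure E' ≃+* AlgebraicClosure E}

/-- **Round trip in degree `1`**: along `E →θ E' →θ' E` with `θ' ∘ θ = id_E`, adapted lifts `(τ, Θ)`,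
`(τ₂, Θ')`, and semilinear `ψ`, `ψ₂` COMPOSING LIKE THE LIFTS (`ψ₂ (ψ m) = ρ γ m` whenever
`τ₂ ∘ τ = γ ∈ Γ_K` on `K̄`), the local actions compose to the identity of `H¹(Γ_E, M)`: the composite
pair is the inner pair of `δ = Θ'Θ ∈ Γ_E` and the composite cocycle `g ↦ δ f(δ⁻¹ g δ)` is `f` plus the
coboundary of `f δ`. [cite: SerreLocalFields1979, VII.§5 Prop. 3] -/
theorem semilinearLocalH_one_semilinearLocalH_one (hτ : IsLiftOfAut σ τ)
    (hΘ : IsLiftOfRingEquiv θ Θ) (hc : LiftsCommute τ Θ) (ψ : M →+ M) (hψ : IsSemilinear ρ hτ ψ)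
    (hτ₂ : IsLiftOfAut σ' τ₂) (hΘ' : IsLiftOfRingEquiv θ' Θ') (hc' : LiftsCommute τ₂ Θ')
    (ψ₂ : M →+ M) (hψ₂ : IsSemilinear ρ hτ₂ ψ₂) (hθθ' : ∀ x, θ' (θ x) = x)
    (hψψ : ∀ γ : absoluteGaloisGroup K, (∀ x, τ₂ (τ x) = γ • x) → ∀ m, ψ₂ (ψ m) = ρ γ m)
    (c : galoisCohomology (GaloisRep.restrictField E ρ) 1) :
    semilinearLocalH hτ₂ hΘ' hc' ψ₂ hψ₂ 1 (semilinearLocalH hτ hΘ hc ψ hψ 1 c) = c := by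
  obtain ⟨δ, hδ⟩ := exists_absoluteGaloisGroup_smul_eq hΘ hΘ' hθθ'
  obtain ⟨f, rfl⟩ := oneCocycleClass_surjective (DiscreteGaloisModule.toTopRep
    (GaloisRep.restrictField E ρ)) c
  have h1 : semilinearLocalH hτ hΘ hc ψ hψ 1 (oneCocycleClass _ f) = oneCocycleClass _
      (contOneCocycles.pullback hΘ.conjGalCMH (semilinearLocalHom hτ hΘ hc ψ hψ) f) :=
    map_oneCocycleClass _ _ _ f
  rw [h1]
  have h2 : semilinearLocalH hτ₂ hΘ' hc' ψ₂ hψ₂ 1 (oneCocycleClass _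
      (contOneCocycles.pullback hΘ.conjGalCMH (semilinearLocalHom hτ hΘ hc ψ hψ) f)) =
      oneCocycleClass _ (contOneCocycles.pullback hΘ'.conjGalCMH
        (semilinearLocalHom hτ₂ hΘ' hc' ψ₂ hψ₂)
        (contOneCocycles.pullback hΘ.conjGalCMH (semilinearLocalHom hτ hΘ hc ψ hψ) f)) :=
    map_oneCocycleClass _ _ _ _
  rw [h2]
  -- Galois side: conjugation by `δ`
  have hgal : ∀ g : absoluteGaloisGroup E,
      hΘ.conjGalCMH (hΘ'.conjGalCMH g) = δ⁻¹ * (g * δ) := by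
    intro g
    apply (MulAction.toPerm_injective (α := absoluteGaloisGroup E) (β := AlgebraicClosure E))
    ext y
    change hΘ.conjGalCMH (hΘ'.conjGalCMH g) • y = (δ⁻¹ * (g * δ)) • y
    rw [mul_smul, mul_smul, hδ, eq_inv_smul_iff, hδ]
    change Θ' (Θ (Θ.symm (Θ'.symm ((show AlgebraicClosure E ≃ₐ[E] AlgebraicClosure E from g)
      (Θ' (Θ y)))))) = _
    rw [RingEquiv.apply_symm_apply, RingEquiv.apply_symm_apply]
    rfl
  -- coefficient side: `ψ₂ ∘ ψ = ρ (res_E δ)`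
  have hcoef : ∀ m : M, ψ₂ (ψ m) = ρ (absGaloisRestrict K E δ) m :=
    hψψ _ (fun x => hc.comp_apply_eq_smul hc' hδ x)
  suffices h : oneCocycleClass _ (contOneCocycles.pullback hΘ'.conjGalCMH
      (semilinearLocalHom hτ₂ hΘ' hc' ψ₂ hψ₂)
      (contOneCocycles.pullback hΘ.conjGalCMH (semilinearLocalHom hτ hΘ hc ψ hψ) f) - f) = 0 by
    rwa [oneCocycleClass_sub, sub_eq_zero] at h
  refine (oneCocycleClass_eq_zero_iff _ _).mpr ⟨f.1 δ, fun g => ?_⟩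
  rw [Submodule.coe_sub, ContinuousMap.sub_apply, contOneCocycles.pullback_apply,
    contOneCocycles.pullback_apply]
  change ψ₂ (ψ (f.1 (hΘ.conjGalCMH (hΘ'.conjGalCMH g)))) - f.1 g = _
  rw [hcoef, hgal]
  change (DiscreteGaloisModule.toTopRep (GaloisRep.restrictField E ρ)).ρ δ
        (f.1 (δ⁻¹ * (g * δ))) - f.1 g =
    (DiscreteGaloisModule.toTopRep (GaloisRep.restrictField E ρ)).ρ g (f.1 δ) - f.1 δ
  rw [contOneCocycles.apply_smul_inv_mul, f.2 g δ]
  abel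

end RoundTrip

/-! ### Compatibility with cup products -/

section Cup

variable {N P : Type u} [AddCommGroup N] [TopologicalSpace N] [DiscreteTopology N]
  [AddCommGroup P] [TopologicalSpace P] [DiscreteTopology P]
  {ρN : DiscreteGaloisModule K N} {ρP : DiscreteGaloisModule K P}
  -- cup products need local compactness of the profinite groups `Γ_E`, `Γ_{E'}` (consumers:
  -- `haveI := absoluteGaloisGroup_compactSpace`); taken as instance arguments, no local instance
  [LocallyCompactSpace (absoluteGaloisGroup E)] [LocallyCompactSpace (absoluteGaloisGroup E')]

/-- **The semilinear local actions commute with cup products.** For an equivariant bi-additive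
`B : M × N → P` of discrete `Γ_K`-modules (`DiscreteGaloisModule.pairing`), adapted lifts and
semilinear `ψ_M`, `ψ_N`, `ψ_P` with `B (ψ_M m) (ψ_N n) = ψ_P (B m n)`:
`σ_*^{(2)} (a ∪ b) = σ_* a ∪ σ_* b` in `H²(Γ_{E'}, P)` for `a ∈ H¹(Γ_E, M)`, `b ∈ H¹(Γ_E, N)` — on the
inhomogeneous cocycle `(g, h) ↦ ⟨f g, f'(g h) − f' g⟩` both sides are
`⟨ψ_M f(Θ⁻¹gΘ), ψ_N (f'(Θ⁻¹ghΘ) − f'(Θ⁻¹gΘ))⟩`. With `B` the evaluation `M × M^∨(1) → μₙ` this is the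
compatibility of the local Tate pairing with `σ_*` up to `inv`.
[cite: NeukirchSchmidtWingberg2008, I §4 (1.4.2) and I §5] [cite: Jetchev2008, §5 Thm. 5.1] -/
theorem semilinearLocalH_cupProduct (hτ : IsLiftOfAut σ τ) (hΘ : IsLiftOfRingEquiv θ Θ)
    (hc : LiftsCommute τ Θ) (B : M →+ N →+ P)
    (hB : ∀ (g : absoluteGaloisGroup K) (m : M) (n : N), B (ρ g m) (ρN g n) = ρP g (B m n))
    (ψM : M →+ M) (hψM : IsSemilinear ρ hτ ψM) (ψN : N →+ N) (hψN : IsSemilinear ρN hτ ψN)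
    (ψP : P →+ P) (hψP : IsSemilinear ρP hτ ψP)
    (hBψ : ∀ m n, B (ψM m) (ψN n) = ψP (B m n))
    (a : galoisCohomology (GaloisRep.restrictField E ρ) 1)
    (b : galoisCohomology (GaloisRep.restrictField E ρN) 1) :
    semilinearLocalH hτ hΘ hc ψP hψP 2
        ((DiscreteGaloisModule.pairing (GaloisRep.restrictField E ρ) (GaloisRep.restrictField E ρN)
          (GaloisRep.restrictField E ρP) B (fun _ m n => hB _ m n)).cupProduct a b) =
      (DiscreteGaloisModule.pairing (GaloisRep.restrictField E' ρ) (GaloisRep.restrictField E' ρN)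
          (GaloisRep.restrictField E' ρP) B (fun _ m n => hB _ m n)).cupProduct
        (semilinearLocalH hτ hΘ hc ψM hψM 1 a) (semilinearLocalH hτ hΘ hc ψN hψN 1 b) := by
  obtain ⟨f, rfl⟩ := oneCocycleClass_surjective _ a
  obtain ⟨f', rfl⟩ := oneCocycleClass_surjective _ b
  have ha : semilinearLocalH hτ hΘ hc ψM hψM 1 (oneCocycleClass _ f) = oneCocycleClass _
      (contOneCocycles.pullback hΘ.conjGalCMH (semilinearLocalHom hτ hΘ hc ψM hψM) f) :=
    map_oneCocycleClass _ _ _ f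
  have hb : semilinearLocalH hτ hΘ hc ψN hψN 1 (oneCocycleClass _ f') = oneCocycleClass _
      (contOneCocycles.pullback hΘ.conjGalCMH (semilinearLocalHom hτ hΘ hc ψN hψN) f') :=
    map_oneCocycleClass _ _ _ f'
  rw [ha, hb, ContPairing.cupProduct_oneCocycleClass_eq_twoCocycleClass,
    ContPairing.cupProduct_oneCocycleClass_eq_twoCocycleClass]
  have h2 : semilinearLocalH hτ hΘ hc ψP hψP 2 (twoCocycleClass _
      ((DiscreteGaloisModule.pairing (GaloisRep.restrictField E ρ) (GaloisRep.restrictField E ρN)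
        (GaloisRep.restrictField E ρP) B (fun _ m n => hB _ m n)).cupCocycle f f')) =
      twoCocycleClass _ (contTwoCocycles.pullback hΘ.conjGalCMH
        (semilinearLocalHom hτ hΘ hc ψP hψP)
        ((DiscreteGaloisModule.pairing (GaloisRep.restrictField E ρ) (GaloisRep.restrictField E ρN)
          (GaloisRep.restrictField E ρP) B (fun _ m n => hB _ m n)).cupCocycle f f')) :=
    map_twoCocycleClass _ _ _ _
  rw [h2]
  congr 1
  refine Subtype.ext (ContinuousMap.ext fun p => ?_)
  obtain ⟨g, h⟩ := p
  rw [contTwoCocycles.pullback_apply, ContPairing.cupCocycle_apply, ContPairing.cupCocycle_apply,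
    contOneCocycles.pullback_apply, contOneCocycles.pullback_apply, contOneCocycles.pullback_apply,
    _root_.map_mul hΘ.conjGalCMH]
  change ψP (B _ _) = B (ψM _) (ψN _ - ψN _)
  rw [← map_sub ψN, hBψ]

end Cup

end Local

end Literature.NumberTheory.EllipticCurves

end
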